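import Mathlib
import Summits.AtomisticToContinuum.Crystallization.Theses.PhononSlackCertificates
import Summits.AtomisticToContinuum.Crystallization.Theorems.PhononSlackCertificatesNearFarGlueRNearMin
import Literature.Algebra.EuclideanLattices.RegevPeriodicGaussianState
import Literature.Geometry.DiscreteGeometry.TwoShellPatterns

/-!
# Crux `PhononSlackCertificates.NearFarGlueR` (stmt-AtomisticToContinuum-14970), line `Sketch`:
SUPERCELLS — the torus form of the residual may assume arbitrarily long periods

Continuation lead c6.  A periodic configuration `P` (lattice `Λ`, motif `F`) is re-presented on the
sublattice `R·Λ` (`R ≥ 1`) with the motif `F + S`, `S` a transversal of `Λ/RΛ` (the register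
representatives `Regev2009.reprSet` of `Literature/Algebra/EuclideanLattices`): the SAME point set and
the SAME energy per particle for every pair potential (`exists_supercell`: the site sum
`Σ'_{y ∈ points, y ≠ x} V(|x − y|)` is invariant under lattice translations of `x`,
`tsum_site_eq_of_mem_lattice`), and the same density of tight contacts (set-goodness and tightness are
lattice-invariant properties of the point set).  Consequently (§3) the torus form of the registered
residual — one `g > 0` with `e* + g·#T(motif)/#motif ≤ e(P)` for every periodic configuration with
`3/10`-separated point set — is EQUIVALENT to its restriction to configurations all of whose non-zero
periods have norm at least `L₀`, for any `L₀` (`torusTightContactGap_iff_longPeriods`,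
`stub_longPeriods`): the period hypotheses `∀ g ∈ Λ ∖ 0, 9/10 ≤ ‖g‖` of the c5 torus lemmas
(`stub_torusLoose`, `stub_torusHole(s)`) cost nothing.  All `[folklore]`.
-/

noncomputable section

namespace Summit.AtomisticToContinuum.Crystallization.Theorems.PhononSlackCertificatesNearFarGlueR

open Literature.MathematicalPhysics.StatisticalMechanics
open Literature.Geometry.DiscreteGeometry
open Literature.Algebra.EuclideanLattices
open Summit.AtomisticToContinuum.Crystallization.Theses.PhononSlackCertificates
open scoped BigOperators Classical
open Filter Topology

variable {d : ℕ}

/-! ## §1 Lattice invariance of the site sum -/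

/-- **The site sum is invariant under lattice translations**: for `g ∈ Λ`,
`Σ'_{y ∈ points, y ≠ x + g} V(|x + g − y|) = Σ'_{y ∈ points, y ≠ x} V(|x − y|)` (re-index by
`y ↦ y + g`, which permutes the point set). [folklore] -/
theorem tsum_site_eq_of_mem_lattice (P : PeriodicConfiguration d) (V : ℝ → ℝ)
    (x : EuclideanSpace ℝ (Fin d)) {g : EuclideanSpace ℝ (Fin d)} (hg : g ∈ P.lattice) :
    (∑' y : {y : EuclideanSpace ℝ (Fin d) // y ∈ P.points ∧ y ≠ x + g}, V (dist (x + g) y.1)) =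
      ∑' y : {y : EuclideanSpace ℝ (Fin d) // y ∈ P.points ∧ y ≠ x}, V (dist x y.1) := by
  -- the translation equivalence between the two index types
  let e : {y : EuclideanSpace ℝ (Fin d) // y ∈ P.points ∧ y ≠ x} ≃
      {y : EuclideanSpace ℝ (Fin d) // y ∈ P.points ∧ y ≠ x + g} :=
    { toFun := fun y => ⟨y.1 + g, P.add_mem_points y.2.1 hg, fun h => y.2.2 (add_right_cancel h)⟩
      invFun := fun y => ⟨y.1 - g, by
          have := P.add_mem_points y.2.1 (P.lattice.neg_mem hg)
          simpa [sub_eq_add_neg] using this, fun h => y.2.2 (eq_add_of_sub_eq h)⟩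
      left_inv := fun y => by ext1; simp
      right_inv := fun y => by ext1; simp }
  rw [← e.tsum_eq]
  refine tsum_congr fun y => ?_
  show V (dist (x + g) (y.1 + g)) = V (dist x y.1)
  rw [dist_add_right]

/-! ## §2 Supercells: same points, same energy, periods multiplied by `R` -/

set_option maxHeartbeats 400000 in
/-- **Supercell re-presentation.**  For every periodic configuration `P` and every `R ≥ 1` there is a
periodic configuration `P'` with lattice `R·Λ` — its periods are exactly the `R`-fold multiples of the
periods of `P` — the same point set, and the same energy per particle for every pair potential.
(Motif `F + S` with `S = Regev2009.reprSet` a transversal of `Λ/RΛ`; the site sums over the new motif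
are `#S` copies of the old ones by `tsum_site_eq_of_mem_lattice`.) [folklore] -/
theorem exists_supercell (P : PeriodicConfiguration d) (R : ℕ) [NeZero R] :
    ∃ P' : PeriodicConfiguration d,
      P'.points = P.points ∧
      (∀ V : ℝ → ℝ, P'.energyPerParticle V = P.energyPerParticle V) ∧
      (∀ g : EuclideanSpace ℝ (Fin d), g ∈ P'.lattice ↔ ∃ g₀ ∈ P.lattice, (R : ℝ) • g₀ = g) ∧
      (∀ w : EuclideanSpace ℝ (Fin d) → ℝ, (∀ y, ∀ g ∈ P.lattice, w (y + g) = w y) →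
        (∑ z ∈ P'.motif, w z) / (P'.motif.card : ℝ) = (∑ y ∈ P.motif, w y) / (P.motif.card : ℝ)) := by
  -- a `ℤ`-basis of the lattice and the transversal of `Λ/RΛ`
  let Λ := P.lattice
  let ι := Module.Free.ChooseBasisIndex ℤ Λ
  let b : Module.Basis ι ℤ Λ := Module.Free.chooseBasis ℤ Λ
  let S : Finset (EuclideanSpace ℝ (Fin d)) := Regev2009.reprSet Λ b R
  have hS : Regev2009.IsTransversal Λ (Regev2009.scaledLattice Λ R) S :=
    Regev2009.isTransversal_reprSet Λ b R
  have hSsub : ∀ s ∈ S, s ∈ Λ := hS.subset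
  have hRΛ : Regev2009.scaledLattice Λ R ≤ Λ := Regev2009.scaledLattice_le Λ R
  -- the new motif `F + S`
  let f : EuclideanSpace ℝ (Fin d) × EuclideanSpace ℝ (Fin d) → EuclideanSpace ℝ (Fin d) :=
    fun p => p.1 + p.2
  have hinj : Set.InjOn f ↑(P.motif ×ˢ S) := by
    rintro ⟨y, s⟩ hys ⟨y', s'⟩ hys' h
    simp only [Finset.coe_product, Set.mem_prod, Finset.mem_coe] at hys hys'
    have hyy : y = y' := by
      refine P.eq_of_sub_mem y hys.1 y' hys'.1 ?_
      have h' : y + s = y' + s' := h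
      have : y - y' = s' - s := by
        rw [sub_eq_sub_iff_add_eq_add, h', add_comm]
      rw [this]
      exact Λ.sub_mem (hSsub _ hys'.2) (hSsub _ hys.2)
    subst hyy
    have hss : s = s' := add_left_cancel h
    rw [hss]
  let F' : Finset (EuclideanSpace ℝ (Fin d)) := (P.motif ×ˢ S).image f
  have hSne : S.Nonempty := by
    obtain ⟨x, hx, -⟩ := hS.unique 0 Λ.zero_mem
    exact ⟨x, hx.1⟩
  have hF'ne : F'.Nonempty := (P.motif_nonempty.product hSne).image f
  have hmemF' : ∀ z, z ∈ F' ↔ ∃ y ∈ P.motif, ∃ s ∈ S, z = y + s := by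
    intro z
    simp only [F', Finset.mem_image, Finset.mem_product, Prod.exists, f]
    constructor
    · rintro ⟨y, s, ⟨hy, hs⟩, rfl⟩; exact ⟨y, hy, s, hs, rfl⟩
    · rintro ⟨y, hy, s, hs, rfl⟩; exact ⟨y, s, ⟨hy, hs⟩, rfl⟩
  have hineq : ∀ z ∈ F', ∀ z' ∈ F', z - z' ∈ Regev2009.scaledLattice Λ R → z = z' := by
    intro z hz z' hz' hzz
    obtain ⟨y, hy, s, hs, rfl⟩ := (hmemF' z).1 hz
    obtain ⟨y', hy', s', hs', rfl⟩ := (hmemF' z').1 hz'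
    have hyy : y = y' := by
      refine P.eq_of_sub_mem y hy y' hy' ?_
      have : y - y' = (y + s - (y' + s')) - (s - s') := by abel
      rw [this]
      exact Λ.sub_mem (hRΛ hzz) (Λ.sub_mem (hSsub _ hs) (hSsub _ hs'))
    subst hyy
    have hss' : s - s' ∈ Regev2009.scaledLattice Λ R := by
      have : s - s' = y + s - (y + s') := by abel
      rw [this]; exact hzz
    -- both `s` and `s'` represent the class of `s`
    obtain ⟨x, -, hx⟩ := hS.unique s (hSsub _ hs)
    have h1 : s = x := hx s ⟨hs, by rw [sub_self]; exact Submodule.zero_mem _⟩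
    have h2 : s' = x := hx s' ⟨hs', hss'⟩
    rw [h1, h2]
  -- the supercell
  let P' : PeriodicConfiguration d :=
    { lattice := Regev2009.scaledLattice Λ R
      discrete := inferInstance
      isZLattice := inferInstance
      motif := F'
      motif_nonempty := hF'ne
      eq_of_sub_mem := hineq }
  -- same point set
  have hpts : P'.points = P.points := by
    ext z
    constructor
    · rintro ⟨w, hw, g', hg', rfl⟩
      obtain ⟨y, hy, s, hs, rfl⟩ := (hmemF' w).1 hw
      refine ⟨y, hy, s + g', Λ.add_mem (hSsub _ hs) (hRΛ hg'), ?_⟩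
      abel
    · rintro ⟨y, hy, g, hg, rfl⟩
      obtain ⟨s, ⟨hs, hgs⟩, -⟩ := hS.unique g hg
      refine ⟨y + s, (hmemF' _).2 ⟨y, hy, s, hs, rfl⟩, g - s, hgs, ?_⟩
      abel
  have hcardF' : F'.card = P.motif.card * S.card := by
    rw [Finset.card_image_of_injOn hinj, Finset.card_product]
  have hScard : (0 : ℝ) < S.card := by exact_mod_cast hSne.card_pos
  have hmcard : (0 : ℝ) < P.motif.card := by exact_mod_cast P.motif_nonempty.card_pos
  refine ⟨P', hpts, fun V => ?_, fun g => Regev2009.mem_scaledLattice Λ, fun w hw => ?_⟩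
  swap
  · -- averages of lattice-invariant functions over the two motifs agree
    have hsumw : ∑ z ∈ F', w z = (S.card : ℝ) * ∑ y ∈ P.motif, w y := by
      rw [Finset.sum_image hinj, Finset.sum_product, Finset.mul_sum]
      refine Finset.sum_congr rfl fun y _ => ?_
      rw [Finset.sum_congr rfl fun s hs => hw y s (hSsub s hs), Finset.sum_const, nsmul_eq_mul]
    show (∑ z ∈ F', w z) / (F'.card : ℝ) = (∑ y ∈ P.motif, w y) / (P.motif.card : ℝ)
    rw [hsumw, hcardF', Nat.cast_mul]
    field_simp
  -- same energy per particle
  have hsite : ∀ z, (∑' y : {y : EuclideanSpace ℝ (Fin d) // y ∈ P'.points ∧ y ≠ z}, V (dist z y.1)) =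
      ∑' y : {y : EuclideanSpace ℝ (Fin d) // y ∈ P.points ∧ y ≠ z}, V (dist z y.1) := by
    intro z
    rw [hpts]
  have hsum : ∑ z ∈ F', (∑' y : {y : EuclideanSpace ℝ (Fin d) // y ∈ P.points ∧ y ≠ z}, V (dist z y.1)) =
      (S.card : ℝ) * ∑ y ∈ P.motif,
        (∑' w : {w : EuclideanSpace ℝ (Fin d) // w ∈ P.points ∧ w ≠ y}, V (dist y w.1)) := by
    rw [Finset.sum_image hinj, Finset.sum_product, Finset.mul_sum]
    refine Finset.sum_congr rfl fun y _ => ?_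
    rw [Finset.sum_congr rfl fun s hs => tsum_site_eq_of_mem_lattice P V y (hSsub s hs),
      Finset.sum_const, nsmul_eq_mul]
  show (2 * (F'.card : ℝ))⁻¹ * ∑ z ∈ F', (∑' y : {y // y ∈ P'.points ∧ y ≠ z}, V (dist z y.1)) =
    (2 * (P.motif.card : ℝ))⁻¹ * ∑ y ∈ P.motif, (∑' w : {w // w ∈ P.points ∧ w ≠ y}, V (dist y w.1))
  simp_rw [hsite]
  rw [hsum, hcardF', Nat.cast_mul]
  field_simp

/-! ## §3 The torus form of the residual may assume arbitrarily long periods -/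

/-- Tightness of a point is a property of the point set, invariant under its lattice translations:
for `g ∈ Λ`, `y + g` is a tight contact of `P` iff `y` is. [folklore] -/
theorem tight_add_iff_of_mem_lattice (P : PeriodicConfiguration 3) {g : EuclideanSpace ℝ (Fin 3)}
    (hg : g ∈ P.lattice) (y : EuclideanSpace ℝ (Fin 3)) :
    (¬ IsTwoShellGoodSet (1 / 20) (47 / 50) 1 P.points (y + g) ∧
        ∃ z ∈ P.points, IsTwoShellGoodSet (1 / 20) (47 / 50) 1 P.points z ∧ dist z (y + g) ≤ 21 / 20) ↔
      (¬ IsTwoShellGoodSet (1 / 20) (47 / 50) 1 P.points y ∧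
        ∃ z ∈ P.points, IsTwoShellGoodSet (1 / 20) (47 / 50) 1 P.points z ∧ dist z y ≤ 21 / 20) := by
  have hneg : -g ∈ P.lattice := P.lattice.neg_mem hg
  constructor
  · rintro ⟨hbad, z, hz, hgood, hdist⟩
    refine ⟨fun h => hbad (forall_not_tight_of_torusTight_of_isMin.isTwoShellGoodSet_add_of_mem_lattice
      P hg h), z - g, ?_, ?_, ?_⟩
    · simpa [sub_eq_add_neg] using P.add_mem_points hz hneg
    · simpa [sub_eq_add_neg] using
        forall_not_tight_of_torusTight_of_isMin.isTwoShellGoodSet_add_of_mem_lattice P hneg hgood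
    · have : dist (z - g) y = dist z (y + g) := by
        rw [dist_eq_norm, dist_eq_norm]; congr 1; abel
      rw [this]; exact hdist
  · rintro ⟨hbad, z, hz, hgood, hdist⟩
    refine ⟨fun h => hbad ?_, z + g, P.add_mem_points hz hg,
      forall_not_tight_of_torusTight_of_isMin.isTwoShellGoodSet_add_of_mem_lattice P hg hgood, ?_⟩
    · have h' := forall_not_tight_of_torusTight_of_isMin.isTwoShellGoodSet_add_of_mem_lattice P hneg h
      simpa using h'
    · rw [dist_add_right]; exact hdist

/-- **Torus form ⟺ torus form with long periods.**  For every `L₀`, one `g > 0` charges every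
periodic configuration with `3/10`-separated point set `g` per tight contact per cell iff one `g > 0`
does so for those among them all of whose non-zero periods have norm at least `L₀`
(re-present `P` on the supercell `R·Λ` with `R ≥ L₀/(3/10)`: same points, same energy per particle,
same tight-contact density; a non-zero period of a `3/10`-separated configuration has norm `≥ 3/10`).
[folklore] -/
theorem torusTightContactGap_iff_longPeriods (L₀ : ℝ) :
    (∃ g : ℝ, 0 < g ∧ ∀ P : PeriodicConfiguration 3,
      (∀ u ∈ P.points, ∀ v ∈ P.points, u ≠ v → (3 / 10 : ℝ) ≤ dist u v) →
      (⨅ Q : PeriodicConfiguration 3, Q.energyPerParticle lennardJones)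
        + g * ((P.motif.filter fun y => ¬ IsTwoShellGoodSet (1 / 20) (47 / 50) 1 P.points y ∧
            ∃ z ∈ P.points, IsTwoShellGoodSet (1 / 20) (47 / 50) 1 P.points z ∧
              dist z y ≤ 21 / 20).card : ℝ) / (P.motif.card : ℝ)
        ≤ P.energyPerParticle lennardJones) ↔
    (∃ g : ℝ, 0 < g ∧ ∀ P : PeriodicConfiguration 3,
      (∀ u ∈ P.points, ∀ v ∈ P.points, u ≠ v → (3 / 10 : ℝ) ≤ dist u v) →
      (∀ g' ∈ P.lattice, g' ≠ 0 → L₀ ≤ ‖g'‖) →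
      (⨅ Q : PeriodicConfiguration 3, Q.energyPerParticle lennardJones)
        + g * ((P.motif.filter fun y => ¬ IsTwoShellGoodSet (1 / 20) (47 / 50) 1 P.points y ∧
            ∃ z ∈ P.points, IsTwoShellGoodSet (1 / 20) (47 / 50) 1 P.points z ∧
              dist z y ≤ 21 / 20).card : ℝ) / (P.motif.card : ℝ)
        ≤ P.energyPerParticle lennardJones) := by
  constructor
  · rintro ⟨g, hg, H⟩
    exact ⟨g, hg, fun P hsep _ => H P hsep⟩
  · rintro ⟨g, hg, H⟩
    refine ⟨g, hg, fun P hsep => ?_⟩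
    -- the supercell factor
    obtain ⟨R, hR⟩ : ∃ R : ℕ, L₀ / (3 / 10) ≤ R := exists_nat_ge _
    let R' : ℕ := R + 1
    haveI : NeZero R' := ⟨Nat.succ_ne_zero R⟩
    have hR' : L₀ / (3 / 10) ≤ (R' : ℝ) := hR.trans (by simp [R'])
    obtain ⟨P', hpts, hE, hlat, hdensP⟩ := exists_supercell P R'
    -- `P'` is `3/10`-separated and has long periods
    have hsep' : ∀ u ∈ P'.points, ∀ v ∈ P'.points, u ≠ v → (3 / 10 : ℝ) ≤ dist u v := by
      rw [hpts]; exact hsep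
    have hper' : ∀ g' ∈ P'.lattice, g' ≠ 0 → L₀ ≤ ‖g'‖ := by
      intro g' hg' hne
      obtain ⟨g₀, hg₀, rfl⟩ := (hlat g').1 hg'
      have hg₀ne : g₀ ≠ 0 := by rintro rfl; exact hne (smul_zero _)
      -- a non-zero period of a `3/10`-separated configuration has norm `≥ 3/10`
      obtain ⟨y, hy⟩ := P.motif_nonempty
      have hy1 : y ∈ P.points := P.mem_points_of_mem_motif hy
      have hy2 : y + g₀ ∈ P.points := P.add_mem_points hy1 hg₀
      have hne' : y ≠ y + g₀ := by
        intro h; exact hg₀ne (by simpa using h.symm)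
      have h30 : (3 / 10 : ℝ) ≤ ‖g₀‖ := by
        have := hsep y hy1 (y + g₀) hy2 hne'
        rwa [dist_eq_norm, show y - (y + g₀) = -g₀ by abel, norm_neg] at this
      have hRpos : (0 : ℝ) < R' := by exact_mod_cast Nat.succ_pos R
      rw [norm_smul, Real.norm_of_nonneg hRpos.le]
      have h1 : L₀ ≤ (R' : ℝ) * (3 / 10) := by
        rw [div_le_iff₀ (by norm_num : (0 : ℝ) < 3 / 10)] at hR'
        exact hR'
      nlinarith
    have hineq := H P' hsep' hper'
    -- transfer: same energy, same tight-contact density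
    rw [hE lennardJones] at hineq
    -- the indicator of tightness (for the point set of `P`), a lattice-invariant function
    let w : EuclideanSpace ℝ (Fin 3) → ℝ := fun y =>
      if (¬ IsTwoShellGoodSet (1 / 20) (47 / 50) 1 P.points y ∧
        ∃ z ∈ P.points, IsTwoShellGoodSet (1 / 20) (47 / 50) 1 P.points z ∧ dist z y ≤ 21 / 20) then 1 else 0
    have hw : ∀ y, ∀ g' ∈ P.lattice, w (y + g') = w y := by
      intro y g' hg'
      have hiff := tight_add_iff_of_mem_lattice P hg' y
      by_cases h : (¬ IsTwoShellGoodSet (1 / 20) (47 / 50) 1 P.points y ∧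
        ∃ z ∈ P.points, IsTwoShellGoodSet (1 / 20) (47 / 50) 1 P.points z ∧ dist z y ≤ 21 / 20)
      · simp only [w, if_pos h, if_pos (hiff.2 h)]
      · simp only [w, if_neg h, if_neg (fun h' => h (hiff.1 h'))]
    have havg := hdensP w hw
    -- the two densities as averages of `w`
    have hP : ((P.motif.filter fun y => ¬ IsTwoShellGoodSet (1 / 20) (47 / 50) 1 P.points y ∧
        ∃ z ∈ P.points, IsTwoShellGoodSet (1 / 20) (47 / 50) 1 P.points z ∧
          dist z y ≤ 21 / 20).card : ℝ) = ∑ y ∈ P.motif, w y := by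
      rw [Finset.card_filter, Nat.cast_sum]
      refine Finset.sum_congr rfl fun y _ => ?_
      by_cases h : (¬ IsTwoShellGoodSet (1 / 20) (47 / 50) 1 P.points y ∧
        ∃ z ∈ P.points, IsTwoShellGoodSet (1 / 20) (47 / 50) 1 P.points z ∧ dist z y ≤ 21 / 20)
      · simp only [w, if_pos h, Nat.cast_one]
      · simp only [w, if_neg h, Nat.cast_zero]
    have hP' : ((P'.motif.filter fun y => ¬ IsTwoShellGoodSet (1 / 20) (47 / 50) 1 P'.points y ∧
        ∃ z ∈ P'.points, IsTwoShellGoodSet (1 / 20) (47 / 50) 1 P'.points z ∧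
          dist z y ≤ 21 / 20).card : ℝ) = ∑ y ∈ P'.motif, w y := by
      rw [Finset.card_filter, Nat.cast_sum]
      refine Finset.sum_congr rfl fun y _ => ?_
      by_cases h : (¬ IsTwoShellGoodSet (1 / 20) (47 / 50) 1 P.points y ∧
        ∃ z ∈ P.points, IsTwoShellGoodSet (1 / 20) (47 / 50) 1 P.points z ∧ dist z y ≤ 21 / 20)
      · have h2 : (¬ IsTwoShellGoodSet (1 / 20) (47 / 50) 1 P'.points y ∧
          ∃ z ∈ P'.points, IsTwoShellGoodSet (1 / 20) (47 / 50) 1 P'.points z ∧ dist z y ≤ 21 / 20) := by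
          rw [hpts]; exact h
        simp only [w, if_pos h, if_pos h2, Nat.cast_one]
      · have h2 : ¬ (¬ IsTwoShellGoodSet (1 / 20) (47 / 50) 1 P'.points y ∧
          ∃ z ∈ P'.points, IsTwoShellGoodSet (1 / 20) (47 / 50) 1 P'.points z ∧ dist z y ≤ 21 / 20) := by
          rw [hpts]; exact h
        simp only [w, if_neg h, if_neg h2, Nat.cast_zero]
    rw [hP', mul_div_assoc, havg, ← hP, ← mul_div_assoc] at hineq
    exact hineq

/-- **Registered sub-goal `stub_longPeriods` of the line `Sketch`** (the statement of
`torusTightContactGap_iff_longPeriods`, for every `L₀`). [folklore] -/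
theorem stub_longPeriods :
    ∀ L₀ : ℝ,
    ((∃ g : ℝ, 0 < g ∧ ∀ P : PeriodicConfiguration 3,
      (∀ u ∈ P.points, ∀ v ∈ P.points, u ≠ v → (3 / 10 : ℝ) ≤ dist u v) →
      (⨅ Q : PeriodicConfiguration 3, Q.energyPerParticle lennardJones)
        + g * ((P.motif.filter fun y => ¬ IsTwoShellGoodSet (1 / 20) (47 / 50) 1 P.points y ∧
            ∃ z ∈ P.points, IsTwoShellGoodSet (1 / 20) (47 / 50) 1 P.points z ∧
              dist z y ≤ 21 / 20).card : ℝ) / (P.motif.card : ℝ)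
        ≤ P.energyPerParticle lennardJones) ↔
    (∃ g : ℝ, 0 < g ∧ ∀ P : PeriodicConfiguration 3,
      (∀ u ∈ P.points, ∀ v ∈ P.points, u ≠ v → (3 / 10 : ℝ) ≤ dist u v) →
      (∀ g' ∈ P.lattice, g' ≠ 0 → L₀ ≤ ‖g'‖) →
      (⨅ Q : PeriodicConfiguration 3, Q.energyPerParticle lennardJones)
        + g * ((P.motif.filter fun y => ¬ IsTwoShellGoodSet (1 / 20) (47 / 50) 1 P.points y ∧
            ∃ z ∈ P.points, IsTwoShellGoodSet (1 / 20) (47 / 50) 1 P.points z ∧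
              dist z y ≤ 21 / 20).card : ℝ) / (P.motif.card : ℝ)
        ≤ P.energyPerParticle lennardJones)) :=
  torusTightContactGap_iff_longPeriods

end Summit.AtomisticToContinuum.Crystallization.Theorems.PhononSlackCertificatesNearFarGlueR

end
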